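import Mathlib
import HarnessLib
import Literature.AlgebraicGeometry.Motives.CartierDivisorCurveDegree
import Literature.AlgebraicGeometry.Resolution.DivisorialPart
import Summits.ResolutionOfSingularities.ResolutionOfSingularities.Theorems.HomologicalConductorNoZenoCycleDivisor

/-!
# Crux `NoZenoR` / `NoZeno` (stmt-ResolutionOfSingularities-19943 / -16483), line `sandwich-cluster`,
# S3 G-layer target Gb — the CARTIER DIVISOR OF AN EXCEPTIONAL CYCLE on a regular surface, II:
# the ORDER dictionary (`Scheme.ord` at the curves) for the cycle divisor

Route `ResolutionOfSingularities/HomologicalConductor`.  OURS (cell res-hironaka, crux chain W4.4, seat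
res-D-pv-026 as res-L0-w44-stub-9, owner of Gb `Sig.stubG_carriedPrincipal`); nothing here is a
statement of the manuscript under review (Hironaka 2017); AI-written, weaker than expert review.

Sequel of `…NoZenoCycleDivisor`: input (P3) of the Gb assembly
(`…NoZenoCarriedPrincipal.carriedPrincipal_of_divisor_of_pred`) in its final form.  For a regular
integral locally Noetherian scheme `X`, a finite set `F` of codimension-one points and a cycle
`W : X → ℕ`, let `D_W := CartierDivisor.ofIsEffectiveCartier (∏_{η ∈ F} 𝓘_{E_η}^{W η}) _` (part I).

* `ord_toFunctionField_eq_of_ring_ord_eq` — Mathlib's order of vanishing `Scheme.ord` of a germ at a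
  codimension-one point `x` is its `Ring.ord` in `𝒪_{X,x}`;
* `isDiscreteValuationRing_stalk_of_coheight_eq_one` — on a regular scheme the local ring at a
  codimension-one point is a discrete valuation ring;
* `le_ord_toFunctionField_iff_mem_maximalIdeal_pow` — for a nonzero germ `τ ∈ 𝒪_{X,η}` (`η` of
  codimension one, `X` regular): `n ≤ ord_η τ ↔ τ ∈ 𝔪_η^n`; `ord_toFunctionField_eq_of_span_eq` —
  `(τ) = 𝔪_η^n ⇒ ord_η τ = n`;
* `mem_stalkIdeal_cycleIdeal_of_forall` — a germ at `x` lying in `(𝓘_{E_η}^{W η})_x` for every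
  `η ∈ F` specialising to `x` lies in `(∏_η 𝓘_{E_η}^{W η})_x` (factoriality of `𝒪_{X,x}`: pairwise
  non-associated prime powers; the tree's `Finset.prod_pow_dvd_of_forall_pow_dvd`);
* **`neg_cycleDivisor_isSection_iff`** — (P3a): `s ∈ Γ(X, 𝒪_X(-D_W))` iff `s` is regular at every
  point and (`s = 0` or `W η ≤ ord_{E_η} s` for all `η ∈ F`);
* **`mem_nonvanishing_neg_cycleDivisor_of_ord_eq`** — (P3b′): if moreover `ord_{E_{η₀}} s = W η₀`
  then `η₀ ∈ X_s`, i.e. `s` generates `𝒪_X(-D_W)` at `η₀` — so the effective divisor `-D_W + div s`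
  avoids `η₀` (tree `CartierDivisor.avoids_add_principal_iff`), which with res-L0-w44-stub-4's
  `excCurveDegree` calculus gives `(𝒪_X(-D_W) · E_{η₀}) ≥ 0` at a gcd cycle.

References: U. Görtz, T. Wedhorn, *Algebraic Geometry I* (2nd ed. 2020), (11.9), Rem. 11.27,
Prop. B.75 [`GortzWedhorn2020`]; V. Cossart, O. Piltant, J. Algebra 320 (2008), proof of Prop. 4.2
(the divisorial part `∏ 𝓘_{E_j}^{a(j)}`) [`CossartPiltant2008`].
-/

noncomputable section

-- single-problem summit: the doubled namespace component `ResolutionOfSingularities` is forced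
set_option linter.dupNamespace false

namespace Summit.ResolutionOfSingularities.ResolutionOfSingularities.Theorems.NoZeno.SandwichCluster

open CategoryTheory AlgebraicGeometry TopologicalSpace IsLocalRing Order
open Literature.AlgebraicGeometry.Resolution Literature.AlgebraicGeometry.Motives

universe u

variable {X : Scheme.{u}} [IsIntegral X] [IsLocallyNoetherian X]

/-! ## §A `Scheme.ord` of a germ at a codimension-one point -/

/-- Mathlib's order of vanishing of (the rational function of) a nonzero germ `t ∈ 𝒪_{X,x}` at a
codimension-one point `x` equals `Ring.ord 𝒪_{X,x} t` (the length of `𝒪_{X,x}/(t)`). [folklore] -/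
theorem ord_toFunctionField_eq_of_ring_ord_eq {x : X} (hx : coheight x = 1)
    {t : X.presheaf.stalk x} (ht : t ≠ 0) {n : ℕ} (hn : Ring.ord (X.presheaf.stalk x) t = n) :
    Scheme.ord (RatFn.toFunctionField x t) x = n := by
  have h0 : RatFn.toFunctionField x t ≠ 0 :=
    (map_ne_zero_iff _ (RatFn.toFunctionField_injective x)).mpr ht
  haveI : Ring.KrullDimLE 1 (X.presheaf.stalk x) := krullDimLE_of_coheight_le hx.le
  have ht' : t ∈ nonZeroDivisors (X.presheaf.stalk x) := mem_nonZeroDivisors_of_ne_zero ht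
  rw [Scheme.ord_eq_iff hx h0]
  change Ring.ordFrac (X.presheaf.stalk x) (algebraMap _ X.functionField t) = _
  rw [Ring.ordFrac_eq_ord _ ht, Ring.ordMonoidWithZeroHom_eq_coe _ ht' hn]

omit [IsLocallyNoetherian X] in
/-- On a regular scheme the local ring at a codimension-one point is a discrete valuation ring.
[folklore] -/
theorem isDiscreteValuationRing_stalk_of_coheight_eq_one (hX : Scheme.IsRegular X) {η : X}
    (hη : coheight η = 1) : IsDiscreteValuationRing (X.presheaf.stalk η) := by
  haveI := isPrincipalIdealRing_stalk_of_coheight_eq_one hX hη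
  exact { not_a_field' := fun h =>
    not_isField_stalk_of_coheight_eq_one hη (isField_iff_maximalIdeal_eq.mpr h) }

/-- **`n ≤ ord_η τ ↔ τ ∈ 𝔪_η^n`** for a nonzero germ `τ` at a codimension-one point `η` of a regular
scheme (`𝒪_{X,η}` a discrete valuation ring with uniformizer `ϖ`: both say `ϖ^n ∣ τ`). [folklore] -/
theorem le_ord_toFunctionField_iff_mem_maximalIdeal_pow (hX : Scheme.IsRegular X) {η : X}
    (hη : coheight η = 1) {τ : X.presheaf.stalk η} (hτ : τ ≠ 0) (n : ℕ) :
    (n : ℤ) ≤ Scheme.ord (RatFn.toFunctionField η τ) η ↔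
      τ ∈ maximalIdeal (X.presheaf.stalk η) ^ n := by
  haveI := isDiscreteValuationRing_stalk_of_coheight_eq_one hX hη
  -- `ord_η τ = addVal τ =: m`
  have hne : IsDiscreteValuationRing.addVal (X.presheaf.stalk η) τ ≠ ⊤ := by
    rw [Ne, IsDiscreteValuationRing.addVal_eq_top_iff]; exact hτ
  obtain ⟨m, hm⟩ := ENat.ne_top_iff_exists.mp hne
  have hord : Scheme.ord (RatFn.toFunctionField η τ) η = m :=
    ord_toFunctionField_eq_of_ring_ord_eq hη hτ (by rw [Ring.ord_eq_addVal, hm])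
  rw [hord, Nat.cast_le]
  -- `τ ∈ 𝔪^n ↔ ϖ^n ∣ τ ↔ n ≤ addVal τ`
  obtain ⟨ϖ, hϖ⟩ := IsDiscreteValuationRing.exists_irreducible (X.presheaf.stalk η)
  rw [hϖ.maximalIdeal_eq, Ideal.span_singleton_pow, Ideal.mem_span_singleton,
    ← IsDiscreteValuationRing.addVal_le_iff_dvd, IsDiscreteValuationRing.addVal_pow,
    IsDiscreteValuationRing.addVal_uniformizer hϖ, ← hm]
  simp

/-- **`(τ) = 𝔪_η^n ⇒ ord_η τ = n`** at a codimension-one point of a regular scheme. [folklore] -/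
theorem ord_toFunctionField_eq_of_span_eq (hX : Scheme.IsRegular X) {η : X} (hη : coheight η = 1)
    {τ : X.presheaf.stalk η} (hτ : τ ≠ 0) {n : ℕ}
    (hspan : Ideal.span {τ} = maximalIdeal (X.presheaf.stalk η) ^ n) :
    Scheme.ord (RatFn.toFunctionField η τ) η = n := by
  refine le_antisymm ?_ ((le_ord_toFunctionField_iff_mem_maximalIdeal_pow hX hη hτ n).mpr
    (hspan ▸ Ideal.subset_span rfl))
  -- `ord ≤ n`: else `𝔪^n = (τ) ⊆ 𝔪^{n+1}`
  by_contra hlt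
  have h1 : ((n + 1 : ℕ) : ℤ) ≤ Scheme.ord (RatFn.toFunctionField η τ) η := by
    push_cast; omega
  rw [le_ord_toFunctionField_iff_mem_maximalIdeal_pow hX hη hτ] at h1
  have hle : maximalIdeal (X.presheaf.stalk η) ^ n ≤ maximalIdeal _ ^ (n + 1) := by
    rw [← hspan, Ideal.span_singleton_le_iff_mem]; exact h1
  exact maximalIdeal_pow_succ_ne (not_isField_stalk_of_coheight_eq_one hη) n
    (le_antisymm (Ideal.pow_le_pow_right (Nat.le_succ n)) hle)

/-! ## §B Germs in the stalk of the cycle ideal sheaf (factoriality) -/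

omit [IsLocallyNoetherian X] in
/-- **A germ lying in `(𝓘_{E_η}^{W η})_x` for every `η ∈ F` specialising to `x` lies in
`(∏_{η ∈ F} 𝓘_{E_η}^{W η})_x`**: in the factorial ring `𝒪_{X,x}` the primes `𝔭_η = (p_η)` of the
codimension-one generisations `η ⤳ x` are principal and pairwise non-associated, so
`∏ p_η^{W η}` divides every common multiple of the `p_η^{W η}` (the other factors of the product are
the unit ideal). [cite: CossartPiltant2008, proof of Prop. 4.2] -/
theorem mem_stalkIdeal_cycleIdeal_of_forall (hX : Scheme.IsRegular X) (F : Finset X) (W : X → ℕ)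
    (hF : ∀ η ∈ F, coheight η = 1) (x : X) {f : X.presheaf.stalk x}
    (hf : ∀ η ∈ F, η ⤳ x → f ∈ stalkIdeal (primeDivisorIdeal η ^ W η) x) :
    f ∈ stalkIdeal (∏ η ∈ F, primeDivisorIdeal η ^ W η) x := by
  classical
  haveI := hX.uniqueFactorizationMonoid_stalk x
  -- prime generators of `𝔭_η` for the generisations `η ⤳ x` in `F`
  have hq : ∀ η : {η // η ∈ F ∧ η ⤳ x}, ∃ q : X.presheaf.stalk x,
      Prime q ∧ primeOfSpecializes η.2.2 = Ideal.span {q} :=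
    fun η => exists_prime_primeOfSpecializes_eq_span η.2.2 (hF η η.2.1)
  choose q hqprime hqspan using hq
  let q' : X → X.presheaf.stalk x := fun η => if h : η ∈ F ∧ η ⤳ x then q ⟨η, h⟩ else 1
  have hq'_pos : ∀ (η : X) (h : η ∈ F ∧ η ⤳ x), q' η = q ⟨η, h⟩ := fun η h => dif_pos h
  have hq'_neg : ∀ η : X, ¬ η ⤳ x → q' η = 1 := fun η h => dif_neg fun hh => h hh.2
  have hstalk : ∀ η ∈ F, stalkIdeal (primeDivisorIdeal η) x = Ideal.span {q' η} := by
    intro η hη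
    by_cases h : η ⤳ x
    · rw [hq'_pos η ⟨hη, h⟩, stalkIdeal_primeDivisorIdeal h]
      exact hqspan ⟨η, hη, h⟩
    · rw [hq'_neg η h, stalkIdeal_primeDivisorIdeal_eq_top h, Ideal.span_singleton_one]
  have hprod : stalkIdeal (∏ η ∈ F, primeDivisorIdeal η ^ W η) x =
      Ideal.span {∏ η ∈ F, q' η ^ W η} := by
    rw [stalkIdeal_cycleIdeal, ← Ideal.prod_span_singleton]
    refine Finset.prod_congr rfl fun η hη => ?_
    rw [hstalk η hη, Ideal.span_singleton_pow]
  rw [hprod, Ideal.mem_span_singleton]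
  -- only the generisations of `x` contribute
  have hsplit : ∏ η ∈ F, q' η ^ W η = ∏ η ∈ F.filter (· ⤳ x), q' η ^ W η := by
    rw [Finset.prod_filter]
    refine Finset.prod_congr rfl fun η _ => ?_
    split_ifs with h
    · rfl
    · rw [hq'_neg η h, one_pow]
  rw [hsplit]
  refine Finset.prod_pow_dvd_of_forall_pow_dvd q' _ _ ?_ ?_ ?_
  · intro η hη
    obtain ⟨hηF, h⟩ := Finset.mem_filter.mp hη
    rw [hq'_pos η ⟨hηF, h⟩]
    exact hqprime _
  · intro η hη η' hη' hne hdvd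
    obtain ⟨hηF, h⟩ := Finset.mem_filter.mp hη
    obtain ⟨hη'F, h'⟩ := Finset.mem_filter.mp hη'
    have hle : primeOfSpecializes h' ≤ primeOfSpecializes h := by
      rw [hqspan ⟨η, hηF, h⟩, hqspan ⟨η', hη'F, h'⟩, ← hq'_pos η ⟨hηF, h⟩,
        ← hq'_pos η' ⟨hη'F, h'⟩]
      exact Ideal.span_singleton_le_span_singleton.mpr hdvd
    exact not_specializes_of_coheight_eq_one (hF η' hη'F) (hF η hηF) (Ne.symm hne)
      (specializes_of_primeOfSpecializes_le h h' hle)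
  · intro η hη
    obtain ⟨hηF, h⟩ := Finset.mem_filter.mp hη
    have h1 := hf η hηF h
    rw [stalkIdeal_pow, hstalk η hηF, Ideal.span_singleton_pow, Ideal.mem_span_singleton] at h1
    exact h1

/-! ## §C The section characterisation of `𝒪_X(-D_W)` and nonvanishing at the curves -/

omit [IsIntegral X] [IsLocallyNoetherian X] in
/-- The stalk at `x` of the ideal sheaf generated by a global section `σ` is generated by the germ of
`σ`. [folklore] -/
theorem stalkIdeal_ofIdealTop_span_singleton (σ : Γ(X, ⊤)) (x : X) :
    stalkIdeal (Scheme.IdealSheafData.ofIdealTop (Ideal.span {σ})) x =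
      Ideal.span {(X.presheaf.germ ⊤ x trivial).hom σ} := by
  obtain ⟨U, hU, hxU, -⟩ :=
    exists_isAffineOpen_mem_and_subset (X := X) (x := x) (U := ⊤) (Opens.mem_top x)
  rw [stalkIdeal_eq_map_germ _ ⟨U, hU⟩ hxU]
  change Ideal.map _ (Ideal.map _ (Ideal.span {σ})) = _
  rw [Ideal.map_map, Ideal.map_span, Set.image_singleton, RingHom.comp_apply,
    ← CommRingCat.comp_apply, TopCat.Presheaf.germ_res]

omit [IsIntegral X] [IsLocallyNoetherian X] in
/-- The germ at `x` of a global section `σ` lies in the stalk of an ideal sheaf `J` as soon as the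
ideal sheaf generated by `σ` is `≤ J`. [folklore] -/
theorem germ_mem_stalkIdeal_of_ofIdealTop_le {J : X.IdealSheafData} {σ : Γ(X, ⊤)}
    (h : Scheme.IdealSheafData.ofIdealTop (Ideal.span {σ}) ≤ J) (x : X) :
    (X.presheaf.germ ⊤ x trivial).hom σ ∈ stalkIdeal J x :=
  stalkIdeal_mono h x (by rw [stalkIdeal_ofIdealTop_span_singleton]; exact Ideal.subset_span rfl)

variable (hX : Scheme.IsRegular X) (F : Finset X) (W : X → ℕ) (hF : ∀ η ∈ F, coheight η = 1)

/-- **(P3a) Global sections of `𝒪_X(-D_W)`**: for the divisor `D_W` of the cycle ideal sheaf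
`∏_{η ∈ F} 𝓘_{E_η}^{W η}` on a regular integral scheme (`F` a finite set of codimension-one points),
a rational function `s` is a global section of `𝒪_X(-D_W)` iff it is regular at every point and either
`s = 0` or `W η ≤ ord_{E_η} s` for every `η ∈ F`.  (`⇒`: at `η` the stalk of the cycle ideal is
`𝔪_η^{W η}`; `⇐`: for each `η` the ideal sheaf of `s` lies in `𝓘_{E_η}^{W η}` by the tree's
`le_primeDivisorIdeal_pow_of_isRegular`, then factoriality at each point.)
[cite: GortzWedhorn2020, Remark 11.27 and (11.12) (pp. 378–379)] -/
theorem neg_cycleDivisor_isSection_iff (s : X.functionField) :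
    (-(CartierDivisor.ofIsEffectiveCartier (∏ η ∈ F, primeDivisorIdeal η ^ W η)
      (isEffectiveCartier_cycleIdeal hX F W hF))).IsSection s ↔
      ((∀ x : X, RatFn.IsRegularAt x s) ∧ (s = 0 ∨ ∀ η ∈ F, (W η : ℤ) ≤ Scheme.ord s η)) := by
  have hanti : ∀ η₀ ∈ F, ∀ η ∈ F, η ⤳ η₀ → η = η₀ := fun η₀ hη₀ η hη h => by
    by_contra hne
    exact not_specializes_of_coheight_eq_one (hF η hη) (hF η₀ hη₀) hne h
  rw [neg_isSection_iff_forall_exists_stalkIdeal]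
  constructor
  · intro h
    refine ⟨fun x => ?_, ?_⟩
    · obtain ⟨σ, -, hσ⟩ := h x
      exact ⟨σ, hσ⟩
    · by_cases hs : s = 0
      · exact Or.inl hs
      · refine Or.inr fun η hη => ?_
        obtain ⟨σ, hσI, hσ⟩ := h η
        rw [stalkIdeal_cycleIdeal_self F W hη (hanti η hη)] at hσI
        have hσ0 : σ ≠ 0 := fun h0 => hs (by rw [← hσ, h0, map_zero])
        rw [← hσ]
        exact (le_ord_toFunctionField_iff_mem_maximalIdeal_pow hX (hF η hη) hσ0 (W η)).mpr hσI
  · rintro ⟨hreg, hord⟩ x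
    by_cases hs : s = 0
    · exact ⟨0, Submodule.zero_mem _, by rw [hs, map_zero]⟩
    have hord' : ∀ η ∈ F, (W η : ℤ) ≤ Scheme.ord s η := hord.resolve_left hs
    -- `s` is a global section `σ`
    obtain ⟨σ, hσ⟩ := RatFn.exists_germ_eq_of_forall_isRegularAt (X := X) (U := ⊤)
      (Set.mem_univ _) (h := s) fun y _ => hreg y
    have hσx : ∀ y : X, RatFn.toFunctionField y ((X.presheaf.germ ⊤ y trivial).hom σ) = s :=
      fun y => by rw [← hσ]; exact RatFn.toFunctionField_germ (Set.mem_univ y) σ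
    refine ⟨(X.presheaf.germ ⊤ x trivial).hom σ, ?_, hσx x⟩
    refine mem_stalkIdeal_cycleIdeal_of_forall hX F W hF x fun η hη _ => ?_
    -- the ideal sheaf of `σ` lies in `𝓘_{E_η}^{W η}`, since `σ_η ∈ 𝔪_η^{W η}`
    refine germ_mem_stalkIdeal_of_ofIdealTop_le
      (le_primeDivisorIdeal_pow_of_isRegular hX (hF η hη) ?_) x
    rw [stalkIdeal_ofIdealTop_span_singleton, Ideal.span_singleton_le_iff_mem]
    have hσ0 : (X.presheaf.germ ⊤ η trivial).hom σ ≠ 0 := fun h0 =>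
      hs (by rw [← hσx η, h0, map_zero])
    refine (le_ord_toFunctionField_iff_mem_maximalIdeal_pow hX (hF η hη) hσ0 (W η)).mp ?_
    rw [hσx η]
    exact hord' η hη

/-- **(P3b′) Nonvanishing at a curve where the order is attained**: with `D_W` as above, a global
section `s` of `𝒪_X(-D_W)` with `ord_{E_{η₀}} s = W η₀` (`η₀ ∈ F`) generates `𝒪_X(-D_W)` at `η₀`,
i.e. `η₀ ∈ X_s` (`CartierDivisor.nonvanishing`): the local equation `g` of `D_W` at `η₀` has
`ord_{η₀} g = W η₀` (its germ generates `𝔪_{η₀}^{W η₀}`), so `g⁻¹ s` is a regular germ of order `0`,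
a unit.  Consequently the effective divisor `-D_W + div(s)` avoids `η₀`
(`CartierDivisor.avoids_add_principal_iff`). [cite: GortzWedhorn2020, Section (11.9) (p. 374)] -/
theorem mem_nonvanishing_neg_cycleDivisor_of_ord_eq {s : X.functionField} (hs : s ≠ 0)
    (hsec : (-(CartierDivisor.ofIsEffectiveCartier (∏ η ∈ F, primeDivisorIdeal η ^ W η)
      (isEffectiveCartier_cycleIdeal hX F W hF))).IsSection s)
    {η₀ : X} (hη₀ : η₀ ∈ F) (hord : Scheme.ord s η₀ = W η₀) :
    η₀ ∈ (-(CartierDivisor.ofIsEffectiveCartier (∏ η ∈ F, primeDivisorIdeal η ^ W η)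
      (isEffectiveCartier_cycleIdeal hX F W hF))).nonvanishing s := by
  set I := (∏ η ∈ F, primeDivisorIdeal η ^ W η) with hI
  set hIc := isEffectiveCartier_cycleIdeal hX F W hF
  set D := CartierDivisor.ofIsEffectiveCartier I hIc with hD
  have hanti : ∀ η ∈ F, η ⤳ η₀ → η = η₀ := fun η hη h => by
    by_contra hne
    exact not_specializes_of_coheight_eq_one (hF η hη) (hF η₀ hη₀) hne h
  have hη₀c : η₀ ∈ (-D).U η₀ := CartierDivisor.mem_cartierChart I hIc η₀
  refine ⟨η₀, hη₀c, ?_⟩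
  -- the local equation `g` at `η₀` and its order
  set g := D.f η₀ with hg
  have hgerm : Ideal.span {(X.presheaf.germ _ η₀ (CartierDivisor.mem_cartierChart I hIc η₀)).hom
      (CartierDivisor.cartierGen I hIc η₀)} = maximalIdeal (X.presheaf.stalk η₀) ^ W η₀ := by
    rw [← stalkIdeal_eq_span_germ_cartierGen I hIc η₀, hI, stalkIdeal_cycleIdeal_self F W hη₀ hanti]
  have hg0 : g ≠ 0 := D.f_ne_zero η₀
  have hgerm0 : (X.presheaf.germ _ η₀ (CartierDivisor.mem_cartierChart I hIc η₀)).hom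
      (CartierDivisor.cartierGen I hIc η₀) ≠ 0 := by
    intro h0
    apply hg0
    rw [hg, CartierDivisor.ofIsEffectiveCartier_f,
      ← RatFn.toFunctionField_germ_eq_secFn (CartierDivisor.mem_cartierChart I hIc η₀)
        (CartierDivisor.mem_cartierChart I hIc η₀), h0, map_zero]
  have hordg : Scheme.ord g η₀ = W η₀ := by
    have h := ord_toFunctionField_eq_of_span_eq hX (hF η₀ hη₀) hgerm0 hgerm
    rwa [RatFn.toFunctionField_germ_eq_secFn (CartierDivisor.mem_cartierChart I hIc η₀)] at h
  -- `g⁻¹ s` is regular of order `0` at `η₀`, hence a unit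
  have hreg : RatFn.IsRegularAt η₀ ((-D).f η₀ * s) := hsec η₀ η₀ hη₀c
  have hne : (-D).f η₀ * s ≠ 0 := mul_ne_zero (inv_ne_zero hg0) hs
  by_contra hu
  have hpos := hreg.ord_pos hu hne (hF η₀ hη₀)
  have hcalc : Scheme.ord ((-D).f η₀ * s) η₀ = 0 := by
    change Scheme.ord (g⁻¹ * s) η₀ = 0
    have hmul := Scheme.ord_mul (x := η₀) (f := g⁻¹ * s) (g := g) hne hg0
    have hsg : g⁻¹ * s * g = s := by field_simp
    rw [hsg, hord, hordg] at hmul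
    -- `ord s = ord (g⁻¹ s) + ord g`
    omega
  rw [hcalc] at hpos
  exact lt_irrefl _ hpos

end Summit.ResolutionOfSingularities.ResolutionOfSingularities.Theorems.NoZeno.SandwichCluster

end
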